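import Mathlib
import Summits.PneNP.PneNP.Theorems.Nc03AvoidResidualCoreReductionBfs

/-!
# Route Nc03AvoidResidualCore, item `ResidualCoreReduction` — balanced patterns and alternating trails

Helper file for `stmt-PneNP-20227` (sequel of `…ReductionBfs`; cell pnp-ideate). For a bipartite
multigraph `G : Bip ι W` and a set `S` of edges, a pattern `y : ι → Bool` is BALANCED on `S`
(`Bal S y`) if at every A-vertex and at every B-vertex the edges of `S` there are half `true`, half
`false`. Balance is preserved by complementing, by changing the pattern off `S`, by disjoint unions,
and forces even degrees. A closed alternating trail presented by its even edges `te k` and odd edges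
`td k` (`te k, td k` share their B-vertex, `td k, te (k+1)` their A-vertex) with the pattern
"`true` exactly on the even edges" is balanced (`bal_trail`). [folklore]
-/

set_option linter.dupNamespace false -- `Summit.PneNP.PneNP.…`: summit = sub-problem name (D-0017 single-conjunct layout)

namespace Summit.PneNP.PneNP.Theorems.Nc03Reduction

open Finset

namespace Bip

variable {ι W : Type*} (G : Bip ι W) [LinearOrder W]

noncomputable section
open Classical

/-! ## Balanced patterns -/

/-- `y` is balanced on `S`: at every vertex, on each side, as many `true` as `false` edges of `S`. -/
def Bal (S : Finset ι) (y : ι → Bool) : Prop :=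
  (∀ a, (S.filter fun j => G.eA j = a ∧ y j = true).card = (S.filter fun j => G.eA j = a ∧ y j = false).card) ∧
  (∀ b, (S.filter fun j => G.eB j = b ∧ y j = true).card = (S.filter fun j => G.eB j = b ∧ y j = false).card)

/-- Balance is preserved by complementing the pattern. -/
theorem Bal.not {S : Finset ι} {y : ι → Bool} (h : G.Bal S y) : G.Bal S (fun j => !y j) := by
  refine ⟨fun a => ?_, fun b => ?_⟩
  · have := h.1 a
    simp only [Bool.not_eq_true', Bool.not_eq_false'] at *
    exact this.symm
  · have := h.2 b
    simp only [Bool.not_eq_true', Bool.not_eq_false'] at *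
    exact this.symm

/-- Balance depends only on the pattern's values on `S`. -/
theorem Bal.congr {S : Finset ι} {y y' : ι → Bool} (h : G.Bal S y) (hyy : ∀ j ∈ S, y j = y' j) :
    G.Bal S y' := by
  have key : ∀ (p : ι → Prop) [DecidablePred p] (c : Bool),
      (S.filter fun j => p j ∧ y' j = c).card = (S.filter fun j => p j ∧ y j = c).card := by
    intro p _ c
    congr 1
    exact Finset.filter_congr fun j hj => by rw [hyy j hj]
  refine ⟨fun a => ?_, fun b => ?_⟩
  · have h1 := key (fun j => G.eA j = a) true
    have h2 := key (fun j => G.eA j = a) false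
    rw [h1, h2]; exact h.1 a
  · have h1 := key (fun j => G.eB j = b) true
    have h2 := key (fun j => G.eB j = b) false
    rw [h1, h2]; exact h.2 b

/-- Balance is additive over disjoint sets. -/
theorem Bal.union {S S' : Finset ι} {y : ι → Bool} (h : G.Bal S y) (h' : G.Bal S' y)
    (hd : Disjoint S S') : G.Bal (S ∪ S') y := by
  have key : ∀ (p : ι → Prop) [DecidablePred p],
      ((S ∪ S').filter p).card = (S.filter p).card + (S'.filter p).card := by
    intro p _
    rw [Finset.filter_union, Finset.card_union_of_disjoint (Finset.disjoint_filter_filter hd)]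
  refine ⟨fun a => ?_, fun b => ?_⟩
  · have h1 := key (fun j => G.eA j = a ∧ y j = true)
    have h2 := key (fun j => G.eA j = a ∧ y j = false)
    rw [h1, h2, h.1 a, h'.1 a]
  · have h1 := key (fun j => G.eB j = b ∧ y j = true)
    have h2 := key (fun j => G.eB j = b ∧ y j = false)
    rw [h1, h2, h.2 b, h'.2 b]

/-- The empty set is balanced. -/
theorem bal_empty (y : ι → Bool) : G.Bal ∅ y := ⟨fun _ => by simp, fun _ => by simp⟩

/-- A balanced set has even degree at every A-vertex. -/
theorem Bal.even_degA {S : Finset ι} {y : ι → Bool} (h : G.Bal S y) (a : W) :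
    Even (S.filter fun j => G.eA j = a).card := by
  have hsplit := Finset.card_filter_add_card_filter_not (s := S.filter fun j => G.eA j = a)
    (fun j => y j = true)
  rw [Finset.filter_filter, Finset.filter_filter] at hsplit
  have e2 : (S.filter fun j => G.eA j = a ∧ ¬ y j = true) = S.filter fun j => G.eA j = a ∧ y j = false := by
    ext j; simp
  rw [e2, h.1 a] at hsplit
  exact ⟨_, hsplit.symm⟩

/-- A balanced set has even degree at every B-vertex. -/
theorem Bal.even_degB {S : Finset ι} {y : ι → Bool} (h : G.Bal S y) (b : W) :
    Even (S.filter fun j => G.eB j = b).card := by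
  have hsplit := Finset.card_filter_add_card_filter_not (s := S.filter fun j => G.eB j = b)
    (fun j => y j = true)
  rw [Finset.filter_filter, Finset.filter_filter] at hsplit
  have e2 : (S.filter fun j => G.eB j = b ∧ ¬ y j = true) = S.filter fun j => G.eB j = b ∧ y j = false := by
    ext j; simp
  rw [e2, h.2 b] at hsplit
  exact ⟨_, hsplit.symm⟩

/-! ## Alternating trails are balanced -/

/-- **Alternating closed trails are balanced.** Even edges `te k` and odd edges `to k` (`k < ℓ`),
all distinct, with `te k, to k` sharing their B-endpoint and `to k, te (k+1 mod ℓ)` their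
A-endpoint: the pattern "`true` on the even edges" is balanced on the trail. -/
theorem bal_trail [DecidableEq ι] (ℓ : ℕ) (hℓ : 0 < ℓ) (te td : ℕ → ι)
    (hB : ∀ k < ℓ, G.eB (te k) = G.eB (td k))
    (hA : ∀ k < ℓ, G.eA (td k) = G.eA (te ((k + 1) % ℓ)))
    (hte : ∀ k < ℓ, ∀ k' < ℓ, te k = te k' → k = k')
    (hto : ∀ k < ℓ, ∀ k' < ℓ, td k = td k' → k = k')
    (hne : ∀ k < ℓ, ∀ k' < ℓ, te k ≠ td k') :
    G.Bal ((range ℓ).image te ∪ (range ℓ).image td)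
      (fun j => decide (j ∈ (range ℓ).image te)) := by
  -- the `true` part of a filter is the image of a filter of `te`, the `false` part of `td`
  have htrue : ∀ (p : ι → Prop) [DecidablePred p],
      (((range ℓ).image te ∪ (range ℓ).image td).filter fun j =>
        p j ∧ decide (j ∈ (range ℓ).image te) = true) = ((range ℓ).filter fun k => p (te k)).image te := by
    intro p _; ext j
    simp only [Finset.mem_filter, Finset.mem_union, Finset.mem_image, Finset.mem_range,
      decide_eq_true_eq]
    constructor
    · rintro ⟨-, hp, k, hk, rfl⟩; exact ⟨k, ⟨hk, hp⟩, rfl⟩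
    · rintro ⟨k, ⟨hk, hp⟩, rfl⟩; exact ⟨Or.inl ⟨k, hk, rfl⟩, hp, k, hk, rfl⟩
  have hfalse : ∀ (p : ι → Prop) [DecidablePred p],
      (((range ℓ).image te ∪ (range ℓ).image td).filter fun j =>
        p j ∧ decide (j ∈ (range ℓ).image te) = false) = ((range ℓ).filter fun k => p (td k)).image td := by
    intro p _; ext j
    simp only [Finset.mem_filter, Finset.mem_union, Finset.mem_image, Finset.mem_range,
      decide_eq_false_iff_not, not_exists, not_and]
    constructor
    · rintro ⟨h1 | ⟨k, hk, rfl⟩, hp, hno⟩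
      · obtain ⟨k, hk, rfl⟩ := h1
        exact absurd rfl (hno k hk)
      · exact ⟨k, ⟨hk, hp⟩, rfl⟩
    · rintro ⟨k, ⟨hk, hp⟩, rfl⟩
      exact ⟨Or.inr ⟨k, hk, rfl⟩, hp, fun k' hk' heq => hne k' hk' k hk heq⟩
  have hinjte : ∀ (p : ι → Prop) [DecidablePred p], (((range ℓ).filter fun k => p (te k)).image te).card =
      ((range ℓ).filter fun k => p (te k)).card := fun p _ =>
    Finset.card_image_of_injOn fun k hk k' hk' h =>
      hte k (Finset.mem_range.1 (Finset.mem_filter.1 hk).1) k'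
        (Finset.mem_range.1 (Finset.mem_filter.1 hk').1) h
  have hinjto : ∀ (p : ι → Prop) [DecidablePred p], (((range ℓ).filter fun k => p (td k)).image td).card =
      ((range ℓ).filter fun k => p (td k)).card := fun p _ =>
    Finset.card_image_of_injOn fun k hk k' hk' h =>
      hto k (Finset.mem_range.1 (Finset.mem_filter.1 hk).1) k'
        (Finset.mem_range.1 (Finset.mem_filter.1 hk').1) h
  refine ⟨fun a => ?_, fun b => ?_⟩
  · beta_reduce
    have h3 := hinjte (fun j => G.eA j = a)
    have h4 := hinjto (fun j => G.eA j = a)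
    beta_reduce at h3 h4
    rw [htrue (fun j => G.eA j = a), hfalse (fun j => G.eA j = a), h3, h4]
    -- reindex `k ↦ (k + 1) % ℓ`
    have hre : ((range ℓ).filter fun k => G.eA (td k) = a) =
        (range ℓ).filter fun k => G.eA (te ((k + 1) % ℓ)) = a := by
      ext k
      simp only [Finset.mem_filter, Finset.mem_range]
      constructor
      · rintro ⟨hk, h⟩; exact ⟨hk, by rw [← hA k hk]; exact h⟩
      · rintro ⟨hk, h⟩; exact ⟨hk, by rw [hA k hk]; exact h⟩
    rw [hre]
    symm
    apply Finset.card_bij (fun k _ => (k + 1) % ℓ)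
    · intro k hk
      simp only [Finset.mem_filter, Finset.mem_range] at hk ⊢
      exact ⟨Nat.mod_lt _ hℓ, hk.2⟩
    · intro k hk k' hk' h
      simp only [Finset.mem_filter, Finset.mem_range] at hk hk'
      have h1 := hk.1; have h2 := hk'.1
      -- `(k+1) % ℓ = (k'+1) % ℓ` with `k, k' < ℓ` forces `k = k'`
      rcases Nat.lt_or_ge (k + 1) ℓ with h3 | h3 <;> rcases Nat.lt_or_ge (k' + 1) ℓ with h4 | h4
      · rw [Nat.mod_eq_of_lt h3, Nat.mod_eq_of_lt h4] at h; omega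
      · rw [Nat.mod_eq_of_lt h3, show k' + 1 = ℓ by omega, Nat.mod_self] at h; omega
      · rw [show k + 1 = ℓ by omega, Nat.mod_self, Nat.mod_eq_of_lt h4] at h; omega
      · omega
    · have hrot : ∀ k' < ℓ, ((k' + ℓ - 1) % ℓ + 1) % ℓ = k' := by
        intro k' hk'
        rcases Nat.eq_zero_or_pos k' with h0 | h0
        · subst h0
          have e1 : (0 + ℓ - 1) % ℓ = ℓ - 1 := by
            rw [Nat.zero_add]; exact Nat.mod_eq_of_lt (by omega)
          rw [e1, Nat.sub_add_cancel hℓ, Nat.mod_self]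
        · have e1 : (k' + ℓ - 1) % ℓ = k' - 1 := by
            rw [show k' + ℓ - 1 = (k' - 1) + ℓ by omega, Nat.add_mod_right]
            exact Nat.mod_eq_of_lt (by omega)
          rw [e1, Nat.sub_add_cancel h0]; exact Nat.mod_eq_of_lt hk'
      intro k' hk'
      simp only [Finset.mem_filter, Finset.mem_range] at hk'
      refine ⟨(k' + ℓ - 1) % ℓ, ?_, hrot k' hk'.1⟩
      simp only [Finset.mem_filter, Finset.mem_range]
      exact ⟨Nat.mod_lt _ hℓ, by rw [hrot k' hk'.1]; exact hk'.2⟩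
  · beta_reduce
    have h3 := hinjte (fun j => G.eB j = b)
    have h4 := hinjto (fun j => G.eB j = b)
    beta_reduce at h3 h4
    rw [htrue (fun j => G.eB j = b), hfalse (fun j => G.eB j = b), h3, h4]
    congr 1
    ext k
    simp only [Finset.mem_filter, Finset.mem_range]
    constructor
    · rintro ⟨hk, h⟩; exact ⟨hk, by rw [← hB k hk]; exact h⟩
    · rintro ⟨hk, h⟩; exact ⟨hk, by rw [hB k hk]; exact h⟩

end

end Bip

end Summit.PneNP.PneNP.Theorems.Nc03Reduction
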